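import Literature.Probability.Percolation.KozmaNitzanPinning
import HarnessLib

/-!
# FK-continuity transplant, FT-06b: pinning laws — the law-generic core of Kozma–Nitzan's Step IV
# (total probability over patterns, the chain (36), the one-direction bound (36)–(37))

Cell `fk-continuity` (bschramm), FRONTIER TRANSPLANT sub-cell, registry row FT-06b (pre-G-T1 infrastructure,
coordinator ruling R15); support file (`--supports stmt-CriticalPhenomena-4575`); builds on p205010 (kernel
theorem, internal audit signed; external expert review pending). HONEST FRAMING: the transplant
`ufsc0_of_freeBoundaryHypothesis_r0` this file serves is CONDITIONAL on the free-boundary penetration hypothesis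
FH (open at the same `p` for `q > 1`; ⇔ GRC Conj. (5.103) via the referee's calibration K1:
"[C3a ∀ p > p_c(q)] ∧ C3b ⇒ p̂_c(q) = p_c(q) = GRC Conj (5.103) = DT Question 5 (open for q ∈ (1,2))"; barrier
note `SamePFreeBoundaryCriteria`, Literature/Barriers/CriticalPhenomena, being landed by fkp-barrier); it is a
typed reduction, not a proof of FK continuity. THIS file is unconditional measure theory on a configuration space
`Set ι`: no named facts, no sorries, standard axioms; nothing here is specific to `q`, to `d`, or to a law.

## What is here

What Kozma–Nitzan's Step IV (arXiv:2401.12397, §4 pp. 30–31: the events `B_j`, the chain (36), the bound (37))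
uses of the law `μ_W` of a weighting `W` is only:
(P) conditioning on the pattern `T` of a finite coordinate set `F` is PINNING, `μ_W(A ∩ [T]_F) = μ_W([T]_F) ·
μ_{pinW W F T}(A)` (product measure: the tree's `prodBernoulli_real_inter_localCylinder`; random-cluster law:
Grimmett 2006 Thm. (3.7), the tree's `rcMeasureW_real_inter_cylinder` / FT-05's `rcMeasureW_real_inter_localCylinder`,
with `pinW w F T = condWeights w Fᶜ T`, file `KNFreePinningLawRC.lean`);
(M) monotonicity in the weights on increasing events (Grimmett (3.22) for `q ≥ 1`);
(S)/(N) the configuration lies in the law's domain, and `{0,1}`-valued weights pin it, almost surely.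
We record (P)(M)(S)(N) as a predicate `IsPinningLaw law D` on a law functor `law : (ι → [0,1]) → Measure (Set ι)`
(pinning valid for coordinate sets inside the domain `D ⊆ ι`) and prove, for ANY such law:

* `IsPinningLaw.real_inter_eq_sum_pinW`, `…real_inter_le_of_pinW_le`, `…real_inter_ge_of_pinW_ge` — the law of
  total probability over the patterns of a finite `F ⊆ D` and the transfer of conditional bounds uniform in the
  pattern (KN p. 20 "`Σ_ξ p_ξ P(· | ξ)`", p. 31 "uniformly over the past");
* `IsPinningLaw.real_anti_of_isLowerSet` — (M) read on decreasing events;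
* `chainEvent` (`G_0 = univ`, `G_{j+1} = A_j ∩ (E_j ∩ G_j)`: KN's `⋂_{i<j} (A'_i ∩ B_i)`),
  `IsPinningLaw.real_chainEvent_le` — **the chain (36)**: `μ_W(G_j) ≤ (1 - δ₂)^j`, by EXACT conditioning at
  each level (no independence: "(36)–(37) are tower identities under the per-direction law", REFUTER-REPORT F4);
* `IsPinningLaw.real_bad_le` — **(36)–(37) for one direction**: `μ_W(bad) ≤ (1 - δ₂)^K + ε'` from the abstract
  Step-III inclusion `bad ⊆ B_j`, the face-crossing inclusions `Reach ∩ L ⊆ A_j` and Lemma 12's `μ_W(Reach) > 1 - ε'`;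
* `measureReal_inter_le_of_subset_biUnion` — the union bound over `≤ N` onward directions behind (33).

Instances: `rcMeasureW w q B` on a finite vertex type (`KNFreePinningLawRC.lean`, `D = univ`), the transplant's
push-forward law `fkLaw Λ W q` on `ℤ^d` (after FT-01; `D` = pairs inside `Λ`), `prodBernoulli` (`q = 1` regression).

## References

* G. Kozma, S. Nitzan, arXiv:2401.12397 (2024), §4 p. 20, p. 22, pp. 30–31 ((36), (37)). [KozmaNitzan2024]
* G. Grimmett, *The Random-Cluster Model*, Springer 2006: Thm. (3.7) p. 39; Thm. (3.21), eq. (3.22). [Grimmett2006]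
* Cell documents: REFUTER-REPORT §8 F4 (prim-bschramm-fkp-18r); transplant/prim-bschramm-fkt-p4/FT06-DESIGN.md.
-/

noncomputable section

open MeasureTheory Finset
open scoped ENNReal Classical

namespace Summit.CriticalPhenomena.PercolationContinuityZ3.Theorems.FK.Transplant

open Literature.Probability.Percolation

section PinningLaw

variable {ι : Type*}

/-- **A pinning law on the domain `D`**: a law functor `W ↦ μ_W` on configurations `Set ι` such that every
`μ_W` is a probability measure, (P) conditioning `μ_W` on the pattern `T` of a finite `F ⊆ D` is the law of the
pinned weighting `pinW W F T`, (M) `μ_W(A) ≤ μ_{W'}(A)` for increasing measurable `A` when `W ≤ W'` on `D`,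
(S) configurations lie inside `D` a.s., and (N) on a countable `K ⊆ D` where `W` is `{0,1}`-valued the
configuration is a.s. the indicated one.
[cite: Grimmett2006, Thm. (3.7) (p. 39) and eq. (3.22); KozmaNitzan2024, §4 p. 30 (Step III, the auxiliary graph)] -/
structure IsPinningLaw (law : (ι → unitInterval) → Measure (Set ι)) (D : Set ι) : Prop where
  /-- every law is a probability measure -/
  prob : ∀ W, IsProbabilityMeasure (law W)
  /-- (P) conditioning on a finite pattern inside `D` is pinning -/
  pin : ∀ W (F : Finset ι), (↑F : Set ι) ⊆ D → ∀ T ⊆ F, ∀ A : Set (Set ι), MeasurableSet A →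
    (law W).real (A ∩ localCylinder ↑F ↑T) = (law W).real (localCylinder ↑F ↑T) * (law (pinW W ↑F ↑T)).real A
  /-- (M) monotonicity in the weights on `D`, for increasing events (the law only reads `D`) -/
  mono : ∀ W W' : ι → unitInterval, (∀ i ∈ D, W i ≤ W' i) →
    ∀ A : Set (Set ι), IsUpperSet A → MeasurableSet A → (law W).real A ≤ (law W').real A
  /-- (S) configurations lie inside `D` almost surely -/
  subset : ∀ W, (law W).real {ω | ω ⊆ D}ᶜ = 0
  /-- (N) `{0,1}`-valued weights on a countable `K ⊆ D` pin the configuration on `K` almost surely -/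
  null : ∀ W (K ξ : Set ι), K ⊆ D → K.Countable → (∀ i ∈ K, i ∈ ξ → W i = 1) → (∀ i ∈ K, i ∉ ξ → W i = 0) →
    (law W).real (localCylinder K ξ)ᶜ = 0

namespace IsPinningLaw

variable {law : (ι → unitInterval) → Measure (Set ι)} {D : Set ι} (hL : IsPinningLaw law D)
include hL

/-- **Law of total probability over the patterns of `F ⊆ D`**: for `A` measurable and `B'` determined by the
finite `F`, `μ_W(A ∩ B') = Σ_{T ⊆ F, T ∈ B'} μ_W([T]_F) · μ_{pinW W F T}(A)`.
[cite: KozmaNitzan2024, §4 p. 20 (Σ_ξ p_ξ P(· | ξ)); Grimmett2006, Thm. (3.7) (p. 39)] -/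
theorem real_inter_eq_sum_pinW (W : ι → unitInterval) {F : Finset ι} (hF : (↑F : Set ι) ⊆ D)
    {A B' : Set (Set ι)} (hA : MeasurableSet A) (hB' : DeterminedBy B' (↑F : Set ι)) :
    (law W).real (A ∩ B') =
      ∑ T ∈ F.powerset.filter (fun T : Finset ι => (↑T : Set ι) ∈ B'),
        (law W).real (localCylinder ↑F ↑T) * (law (pinW W ↑F ↑T)).real A := by
  haveI := hL.prob W
  have hdec : A ∩ B' = ⋃ T ∈ F.powerset.filter (fun T : Finset ι => (↑T : Set ι) ∈ B'),
      A ∩ localCylinder (↑F : Set ι) ↑T := by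
    ext ω
    constructor
    · rintro ⟨hωA, hωB⟩
      have hT : F.filter (· ∈ ω) ⊆ F := Finset.filter_subset _ _
      have hω : ω ∈ localCylinder (↑F : Set ι) ↑(F.filter (· ∈ ω)) := mem_localCylinder_filter F ω
      refine Set.mem_iUnion₂.2 ⟨F.filter (· ∈ ω), ?_, hωA, hω⟩
      exact Finset.mem_filter.2 ⟨Finset.mem_powerset.2 hT, (mem_iff_coe_mem_of_determinedBy hB' hT hω).1 hωB⟩
    · intro hω
      obtain ⟨T, hT, hωA, hωT⟩ := Set.mem_iUnion₂.1 hω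
      obtain ⟨hTF, hTB⟩ := Finset.mem_filter.1 hT
      exact ⟨hωA, (mem_iff_coe_mem_of_determinedBy hB' (Finset.mem_powerset.1 hTF) hωT).2 hTB⟩
  rw [hdec, measureReal_biUnion_finset]
  · refine Finset.sum_congr rfl fun T hT => ?_
    exact hL.pin W F hF T (Finset.mem_powerset.1 (Finset.mem_filter.1 hT).1) A hA
  · intro T hT T' hT' hne
    have h1 : T ⊆ F := Finset.mem_powerset.1 (Finset.mem_filter.1 (Finset.mem_coe.1 hT)).1
    have h2 : T' ⊆ F := Finset.mem_powerset.1 (Finset.mem_filter.1 (Finset.mem_coe.1 hT')).1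
    exact (localCylinder_disjoint h1 h2 hne).mono Set.inter_subset_right Set.inter_subset_right
  · intro T _
    exact hA.inter (measurableSet_localCylinder F.finite_toSet.countable _)

/-- The case `A = univ`: `μ_W(B') = Σ_{T ⊆ F, T ∈ B'} μ_W([T]_F)`. [folklore] -/
theorem real_eq_sum_localCylinder (W : ι → unitInterval) {F : Finset ι} (hF : (↑F : Set ι) ⊆ D)
    {B' : Set (Set ι)} (hB' : DeterminedBy B' (↑F : Set ι)) :
    (law W).real B' =
      ∑ T ∈ F.powerset.filter (fun T : Finset ι => (↑T : Set ι) ∈ B'), (law W).real (localCylinder ↑F ↑T) := by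
  have h := hL.real_inter_eq_sum_pinW W hF MeasurableSet.univ hB'
  rw [Set.univ_inter] at h
  rw [h]
  refine Finset.sum_congr rfl fun T _ => ?_
  haveI := hL.prob (pinW W ↑F ↑T)
  rw [probReal_univ, mul_one]

/-- **Transfer of an upper bound on the conditional probabilities** (one step of the chain (36)): if
`μ_{pinW W F T}(A) ≤ c` for every pattern `T ⊆ F` with `T ∈ B'`, then `μ_W(A ∩ B') ≤ c · μ_W(B')`.
[cite: KozmaNitzan2024, §4 p. 31 ((36))] -/
theorem real_inter_le_of_pinW_le (W : ι → unitInterval) {F : Finset ι} (hF : (↑F : Set ι) ⊆ D)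
    {A B' : Set (Set ι)} (hA : MeasurableSet A) (hB' : DeterminedBy B' (↑F : Set ι)) {c : ℝ}
    (h : ∀ T ⊆ F, (↑T : Set ι) ∈ B' → (law (pinW W ↑F ↑T)).real A ≤ c) :
    (law W).real (A ∩ B') ≤ c * (law W).real B' := by
  rw [hL.real_inter_eq_sum_pinW W hF hA hB', hL.real_eq_sum_localCylinder W hF hB', Finset.mul_sum]
  refine Finset.sum_le_sum fun T hT => ?_
  obtain ⟨hT1, hT2⟩ := Finset.mem_filter.1 hT
  rw [mul_comm c]
  exact mul_le_mul_of_nonneg_left (h T (Finset.mem_powerset.1 hT1) hT2) measureReal_nonneg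

/-- **Transfer of a lower bound on the conditional probabilities.** [cite: KozmaNitzan2024, §4 p. 22] -/
theorem real_inter_ge_of_pinW_ge (W : ι → unitInterval) {F : Finset ι} (hF : (↑F : Set ι) ⊆ D)
    {A B' : Set (Set ι)} (hA : MeasurableSet A) (hB' : DeterminedBy B' (↑F : Set ι)) {c : ℝ}
    (h : ∀ T ⊆ F, (↑T : Set ι) ∈ B' → c ≤ (law (pinW W ↑F ↑T)).real A) :
    c * (law W).real B' ≤ (law W).real (A ∩ B') := by
  rw [hL.real_inter_eq_sum_pinW W hF hA hB', hL.real_eq_sum_localCylinder W hF hB', Finset.mul_sum]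
  refine Finset.sum_le_sum fun T hT => ?_
  obtain ⟨hT1, hT2⟩ := Finset.mem_filter.1 hT
  rw [mul_comm c]
  exact mul_le_mul_of_nonneg_left (h T (Finset.mem_powerset.1 hT1) hT2) measureReal_nonneg

/-- (M) read on decreasing events: `W ≤ W'` on `D` ⇒ `μ_{W'}(B) ≤ μ_W(B)` for decreasing measurable `B`.
[cite: Grimmett2006, Thm. (3.21), eq. (3.22)] -/
theorem real_anti_of_isLowerSet {W W' : ι → unitInterval} (hle : ∀ i ∈ D, W i ≤ W' i)
    {B : Set (Set ι)} (hB : IsLowerSet B) (hBm : MeasurableSet B) : (law W').real B ≤ (law W).real B := by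
  haveI := hL.prob W
  haveI := hL.prob W'
  have h := hL.mono W W' hle Bᶜ hB.compl hBm.compl
  rw [measureReal_compl hBm, measureReal_compl hBm, probReal_univ, probReal_univ] at h
  linarith

/-- An event is unchanged by intersecting with an almost sure set. [folklore] -/
theorem real_inter_eq_of_compl_null (W : ι → unitInterval) {N : Set (Set ι)} (hN : (law W).real Nᶜ = 0)
    (hNm : MeasurableSet N) (A : Set (Set ι)) : (law W).real (A ∩ N) = (law W).real A := by
  haveI := hL.prob W
  have hle : (law W).real (A \ N) = 0 :=
    le_antisymm ((measureReal_mono (Set.sdiff_subset_compl _ _) (measure_ne_top _ _)).trans hN.le) measureReal_nonneg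
  have := measureReal_inter_add_sdiff₀ (μ := law W) (s := A) hNm.nullMeasurableSet
  rw [hle, add_zero] at this
  exact this

end IsPinningLaw

/-! ### KN's chain (36) and the bound (36)–(37), for a pinning law -/

/-- KN's events `G_j = ⋂_{i<j} (A'_i ∩ B_i)`, abstractly: `G 0 = univ`, `G (j+1) = A j ∩ (E j ∩ G j)`.
[cite: KozmaNitzan2024, §4 p. 31 ((36))] -/
def chainEvent (A E : ℕ → Set (Set ι)) : ℕ → Set (Set ι)
  | 0 => Set.univ
  | j + 1 => A j ∩ (E j ∩ chainEvent A E j)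

/-- `G_j` is determined by `Fp j` (for `A i` determined by `Fp (i+1)`, `E i` by `Fp i`, `Fp` monotone).
[folklore] -/
theorem determinedBy_chainEvent {A E : ℕ → Set (Set ι)} {Fp : ℕ → Finset ι}
    (hFp : ∀ j, Fp j ⊆ Fp (j + 1)) (hA : ∀ j, DeterminedBy (A j) (↑(Fp (j + 1)) : Set ι))
    (hE : ∀ j, DeterminedBy (E j) (↑(Fp j) : Set ι)) :
    ∀ j, DeterminedBy (chainEvent A E j) (↑(Fp j) : Set ι)
  | 0 => determinedBy_univ _
  | j + 1 => by
    have hmono : (↑(Fp j) : Set ι) ⊆ ↑(Fp (j + 1)) := Finset.coe_subset.2 (hFp j)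
    exact (hA j).inter (((hE j).mono hmono).inter ((determinedBy_chainEvent hFp hA hE j).mono hmono))

/-- `G_j` is measurable (for measurable `A i`, `E i`). [folklore] -/
theorem measurableSet_chainEvent {A E : ℕ → Set (Set ι)} (hA : ∀ j, MeasurableSet (A j))
    (hE : ∀ j, MeasurableSet (E j)) : ∀ j, MeasurableSet (chainEvent A E j)
  | 0 => MeasurableSet.univ
  | j + 1 => (hA j).inter ((hE j).inter (measurableSet_chainEvent hA hE j))

/-- **The chain (36)**: for a pinning law on `D`, coordinate sets `Fp j ⊆ D` increasing in `j`, `A j`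
measurable and determined by `Fp (j+1)`, `E j` measurable and determined by `Fp j`: if for every `j < K` and
every pattern `T ⊆ Fp j` in `E j` the pinned law gives `μ_{pinW W (Fp j) T}(A j) ≤ 1 - δ₂` (`δ₂ ≤ 1`), then
`μ_W(G_j) ≤ (1 - δ₂)^j` for all `j ≤ K`. Exact conditioning at each step — no independence ("(36)–(37) are
tower identities under `P^x`", refuter F4(a)). [cite: KozmaNitzan2024, §4 p. 31 ((36))] -/
theorem IsPinningLaw.real_chainEvent_le {law : (ι → unitInterval) → Measure (Set ι)} {D : Set ι}
    (hL : IsPinningLaw law D) (W : ι → unitInterval) {A E : ℕ → Set (Set ι)} {Fp : ℕ → Finset ι}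
    (hFpD : ∀ j, (↑(Fp j) : Set ι) ⊆ D) (hFp : ∀ j, Fp j ⊆ Fp (j + 1))
    (hA : ∀ j, DeterminedBy (A j) (↑(Fp (j + 1)) : Set ι)) (hAm : ∀ j, MeasurableSet (A j))
    (hE : ∀ j, DeterminedBy (E j) (↑(Fp j) : Set ι)) (hEm : ∀ j, MeasurableSet (E j))
    {K : ℕ} {δ₂ : ℝ} (hδ₂ : δ₂ ≤ 1)
    (hstep : ∀ j < K, ∀ T ⊆ Fp j, (↑T : Set ι) ∈ E j → (law (pinW W ↑(Fp j) ↑T)).real (A j) ≤ 1 - δ₂) :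
    ∀ j ≤ K, (law W).real (chainEvent A E j) ≤ (1 - δ₂) ^ j
  | 0, _ => by
    haveI := hL.prob W
    rw [pow_zero]; exact measureReal_le_one
  | j + 1, hj => by
    haveI := hL.prob W
    have hj' : j < K := by omega
    have ih := hL.real_chainEvent_le W hFpD hFp hA hAm hE hEm hδ₂ hstep j hj'.le
    have hdet : DeterminedBy (E j ∩ chainEvent A E j) (↑(Fp j) : Set ι) :=
      (hE j).inter (determinedBy_chainEvent hFp hA hE j)
    change (law W).real (A j ∩ (E j ∩ chainEvent A E j)) ≤ (1 - δ₂) ^ (j + 1)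
    refine (hL.real_inter_le_of_pinW_le W (hFpD j) (hAm j) hdet fun T hT hTE => hstep j hj' T hT hTE.1).trans ?_
    rw [pow_succ, mul_comm ((1 - δ₂) ^ j)]
    refine mul_le_mul_of_nonneg_left (le_trans (measureReal_mono Set.inter_subset_right (measure_ne_top _ _)) ih) ?_
    linarith

/-- **(36)–(37) for one direction**: with the data of `real_chainEvent_le`, if a `bad` configuration lies in
every `Bv j` (Step III), if `Bv j ∩ L' ⊆ E j` and `Reach ∩ L ⊆ A j` for almost sure `L`, `L'` ("to
hit `M_x` via `H_{v,x}` you must pass through all the `F^j`"), and if `Reach` (measurable) has probability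
`> 1 - ε'` (Lemma 12), then `μ_W(bad) ≤ (1 - δ₂)^K + ε'`. [cite: KozmaNitzan2024, §4 p. 31 ((36), (37))] -/
theorem IsPinningLaw.real_bad_le {law : (ι → unitInterval) → Measure (Set ι)} {D : Set ι}
    (hL : IsPinningLaw law D) (W : ι → unitInterval) {A E Bv : ℕ → Set (Set ι)} {Fp : ℕ → Finset ι}
    (hFpD : ∀ j, (↑(Fp j) : Set ι) ⊆ D) (hFp : ∀ j, Fp j ⊆ Fp (j + 1))
    (hA : ∀ j, DeterminedBy (A j) (↑(Fp (j + 1)) : Set ι)) (hAm : ∀ j, MeasurableSet (A j))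
    (hE : ∀ j, DeterminedBy (E j) (↑(Fp j) : Set ι)) (hEm : ∀ j, MeasurableSet (E j))
    {K : ℕ} {δ₂ ε' : ℝ} (hδ₂ : δ₂ ≤ 1)
    (hstep : ∀ j < K, ∀ T ⊆ Fp j, (↑T : Set ι) ∈ E j → (law (pinW W ↑(Fp j) ↑T)).real (A j) ≤ 1 - δ₂)
    {bad Reach L L' : Set (Set ι)} (hL0 : (law W).real Lᶜ = 0) (hL'0 : (law W).real L'ᶜ = 0)
    (hRm : MeasurableSet Reach)
    (hbad : ∀ j < K, bad ⊆ Bv j) (hEB : ∀ j < K, Bv j ∩ L' ⊆ E j)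
    (hreachA : ∀ j < K, Reach ∩ L ⊆ A j) (hreach : 1 - ε' < (law W).real Reach) :
    (law W).real bad ≤ (1 - δ₂) ^ K + ε' := by
  haveI := hL.prob W
  set μ := law W with hμ
  have hG : ∀ j ≤ K, bad ∩ Reach ∩ (L ∩ L') ⊆ chainEvent A E j := by
    intro j
    induction j with
    | zero => intro _ _ _; exact Set.mem_univ _
    | succ j ih =>
      intro hj ω hω
      obtain ⟨⟨hb, hR⟩, hωL, hωL'⟩ := hω
      have hj' : j < K := by omega
      exact ⟨hreachA j hj' ⟨hR, hωL⟩, hEB j hj' ⟨hbad j hj' hb, hωL'⟩, ih (by omega) ⟨⟨hb, hR⟩, hωL, hωL'⟩⟩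
  have hsub : bad ⊆ chainEvent A E K ∪ Reachᶜ ∪ (Lᶜ ∪ L'ᶜ) := by
    intro ω hb
    by_cases hR : ω ∈ Reach
    · by_cases hωL : ω ∈ L
      · by_cases hωL' : ω ∈ L'
        · exact Or.inl (Or.inl (hG K le_rfl ⟨⟨hb, hR⟩, hωL, hωL'⟩))
        · exact Or.inr (Or.inr hωL')
      · exact Or.inr (Or.inl hωL)
    · exact Or.inl (Or.inr hR)
  have hnull : μ.real (Lᶜ ∪ L'ᶜ) = 0 :=
    le_antisymm ((measureReal_union_le _ _).trans (by rw [hL0, hL'0, add_zero])) measureReal_nonneg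
  have hRc : μ.real Reachᶜ < ε' := by
    rw [measureReal_compl hRm, probReal_univ]; linarith
  calc μ.real bad ≤ μ.real (chainEvent A E K ∪ Reachᶜ ∪ (Lᶜ ∪ L'ᶜ)) := measureReal_mono hsub (measure_ne_top _ _)
    _ ≤ μ.real (chainEvent A E K ∪ Reachᶜ) + μ.real (Lᶜ ∪ L'ᶜ) := measureReal_union_le _ _
    _ ≤ μ.real (chainEvent A E K) + μ.real Reachᶜ + 0 := by
        rw [hnull]; exact add_le_add (measureReal_union_le _ _) le_rfl
    _ ≤ (1 - δ₂) ^ K + ε' := by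
        rw [add_zero]
        exact add_le_add (hL.real_chainEvent_le W hFpD hFp hA hAm hE hEm hδ₂ hstep K le_rfl) hRc.le

/-- **(33), the union over the onward directions**: if the failure event lies in the union of the `bad i`
over a finset of `≤ N` directions and `μ(bad i ∩ C) ≤ (ε/N) μ(C)` for each, then `μ(fail ∩ C) ≤ ε μ(C)`
(here `C` is the history cylinder and the per-direction bounds are the transferred ones).
[cite: KozmaNitzan2024, §4 p. 28 ((33))] -/
theorem measureReal_inter_le_of_subset_biUnion {Ω κ : Type*} [MeasurableSpace Ω] (μ : Measure Ω) [IsFiniteMeasure μ]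
    (dirs : Finset κ) {N : ℕ} (hcard : dirs.card ≤ N) (bad : κ → Set Ω)
    {fail C : Set Ω} (hfail : fail ⊆ ⋃ i ∈ dirs, bad i) {ε : ℝ} (hε : 0 ≤ ε)
    (hb : ∀ i ∈ dirs, μ.real (bad i ∩ C) ≤ ε / N * μ.real C) :
    μ.real (fail ∩ C) ≤ ε * μ.real C := by
  have hsub : fail ∩ C ⊆ ⋃ i ∈ dirs, (bad i ∩ C) := by
    rintro ω ⟨hω, hC⟩
    obtain ⟨i, hi, hωi⟩ := Set.mem_iUnion₂.1 (hfail hω)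
    exact Set.mem_iUnion₂.2 ⟨i, hi, hωi, hC⟩
  have hC0 : 0 ≤ μ.real C := measureReal_nonneg
  by_cases hN : N = 0
  · have hdirs : dirs = ∅ := Finset.card_eq_zero.1 (Nat.le_zero.1 (hN ▸ hcard))
    rw [hdirs] at hsub
    simp only [Finset.notMem_empty, Set.iUnion_of_empty, Set.iUnion_empty, Set.subset_empty_iff] at hsub
    rw [hsub, measureReal_empty]; exact mul_nonneg hε hC0
  have hNpos : (0 : ℝ) < N := by exact_mod_cast Nat.pos_of_ne_zero hN
  calc μ.real (fail ∩ C) ≤ μ.real (⋃ i ∈ dirs, (bad i ∩ C)) := measureReal_mono hsub (measure_ne_top _ _)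
    _ ≤ ∑ i ∈ dirs, μ.real (bad i ∩ C) := measureReal_biUnion_finset_le _ _
    _ ≤ ∑ i ∈ dirs, ε / N * μ.real C := Finset.sum_le_sum hb
    _ = dirs.card * (ε / N * μ.real C) := by rw [Finset.sum_const, nsmul_eq_mul]
    _ ≤ N * (ε / N * μ.real C) :=
        mul_le_mul_of_nonneg_right (by exact_mod_cast hcard) (mul_nonneg (div_nonneg hε hNpos.le) hC0)
    _ = ε * μ.real C := by field_simp

end PinningLaw

end Summit.CriticalPhenomena.PercolationContinuityZ3.Theorems.FK.Transplant

end
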